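import Summits.HubbardSuperconductivity.HubbardSuperconductivity.Theses.ChiralWindow
import Summits.HubbardSuperconductivity.HubbardSuperconductivity.Theorems.WcbcsSsbToTorusLRO.Negative.SummitMatrixUniformFloor
import Literature.MathematicalPhysics.QuantumLattice.FinDimSpectrumSectorGibbsLimit

/-!
# Crux `CwThesis` (item `stmt-HubbardSuperconductivity-10438`): no floor survives `U → 0` at a fixed side —
# the constants of the target cannot be uniform in the coupling (modulo the free bound)

Negative-side support (standing disprover, generation 1). Fix a side `L ≥ 3` and a sector `(2n, S^z = 0)`,
`n ≤ L²`. If the pair intensity `I(ψ) = re⟨ψ, P†P ψ⟩` (`P = pairField dWaveFormFactor L`) of every normalised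
ground state of the FREE torus in that sector is `≤ C`, then NO floor `a > C` can hold for all normalised ground
states of `hubbardTorus 2 L 1 U_j` in that sector along ANY sequence of couplings `U_j → 0`
(`no_floor_along_vanishing_couplings`): by compactness of the unit sphere a subsequence of ground states
converges, the limit is a ground state of the free torus in the same sector (the sector energies converge because
`H(U) = H(0) + U·D` with `D = Σ_x n_{x↑}n_{x↓}`), and the floor passes to the limit. With the free bound
`C = 320 L²` (file `FreeEndpointFermiStep.lean`) this refutes every strengthening of `CwThesis` whose floor constant AND
finite-size threshold are uniform in `U` (corollary `cwThesis_false_uniformFloor_of_freeBound`; unconditional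
form in `FreeEndpointCorollaries.lean`). Folklore finite-dimensional perturbation theory; no definitions.
-/

noncomputable section

namespace Summit.HubbardSuperconductivity.CwThesis.Negative

open Matrix Finset Literature.MathematicalPhysics.QuantumLattice Literature.Barriers.HubbardSuperconductivity
open Literature.Probability.LatticeModels
open Filter Set
open scoped ComplexOrder Topology
open Summit.HubbardSuperconductivity.WcbcsSsbToTorusLRO.Negative

variable {L : ℕ}

/-- The coupling enters linearly: `H(U) = H(0) + U · Σ_x n_{x↑} n_{x↓}`. [folklore] -/
theorem hubbardTorus_eq_add_smul (L : ℕ) (U : ℝ) :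
    hubbardTorus 2 L 1 U = hubbardTorus 2 L 1 0 +
      (U : ℂ) • ∑ x : FermionTorus 2 L, numberOp x 0 * numberOp x 1 := by
  simp only [hubbardTorus, hamiltonian, Complex.ofReal_zero, zero_smul, add_zero]

/-- The unit sphere `{φ : star φ ⬝ᵥ φ = 1}` of the Fock space is compact. [folklore] -/
theorem isCompact_unitSphere_fock (L : ℕ) :
    IsCompact {φ : Fock (Orb (FermionTorus 2 L)) | star φ ⬝ᵥ φ = 1} := by
  have hclosed : IsClosed {φ : Fock (Orb (FermionTorus 2 L)) | star φ ⬝ᵥ φ = 1} :=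
    isClosed_eq (continuous_id.star.dotProduct continuous_id) continuous_const
  refine Metric.isCompact_of_isClosed_isBounded hclosed ?_
  refine (Metric.isBounded_closedBall (x := (0 : Fock (Orb (FermionTorus 2 L)))) (r := 1)).subset ?_
  intro φ hφ
  rw [Set.mem_setOf_eq] at hφ
  rw [Metric.mem_closedBall, dist_zero_right, pi_norm_le_iff_of_nonneg zero_le_one]
  intro s
  have hsum : (star φ ⬝ᵥ φ).re = ∑ t, ‖φ t‖ ^ 2 := by
    simp only [dotProduct, Pi.star_apply, Complex.re_sum, Complex.star_def, Complex.conj_mul',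
      ← Complex.ofReal_pow, Complex.ofReal_re]
  have hle : ‖φ s‖ ^ 2 ≤ 1 := by
    calc ‖φ s‖ ^ 2 ≤ ∑ t, ‖φ t‖ ^ 2 :=
          Finset.single_le_sum (f := fun t => ‖φ t‖ ^ 2) (fun t _ => sq_nonneg _) (Finset.mem_univ s)
      _ = 1 := by rw [← hsum, hφ, Complex.one_re]
  nlinarith [norm_nonneg (φ s)]

/-- **No floor survives `U → 0` at a fixed side and sector** (modulo a free bound). If every normalised ground
state of the free torus `hubbardTorus 2 L 1 0` in the sector `(2n, 0)` has pair intensity `≤ C`, and `C < a`,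
then along no sequence `U_j → 0` can ALL normalised ground states of `hubbardTorus 2 L 1 U_j` in that sector have
pair intensity `≥ a`. [folklore] -/
theorem no_floor_along_vanishing_couplings [NeZero L] {n : ℕ} (hn : n ≤ L ^ 2) {C a : ℝ} (hCa : C < a)
    (hfree : ∀ ψ : Fock (Orb (FermionTorus 2 L)),
      IsGroundStateInSector (hubbardTorus 2 L 1 0) (2 * n) 0 ψ → star ψ ⬝ᵥ ψ = 1 →
        (expect ((pairField dWaveFormFactor L)ᴴ * pairField dWaveFormFactor L) ψ).re ≤ C)
    (U : ℕ → ℝ) (hU0 : Tendsto U atTop (𝓝 0))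
    (hfloor : ∀ (j : ℕ) (ψ : Fock (Orb (FermionTorus 2 L))),
      IsGroundStateInSector (hubbardTorus 2 L 1 (U j)) (2 * n) 0 ψ → star ψ ⬝ᵥ ψ = 1 →
        a ≤ (expect ((pairField dWaveFormFactor L)ᴴ * pairField dWaveFormFactor L) ψ).re) :
    False := by
  classical
  -- notation
  set H : ℝ → Matrix (Finset (Orb (FermionTorus 2 L))) (Finset (Orb (FermionTorus 2 L))) ℂ :=
    fun V => hubbardTorus 2 L 1 V with hH
  set D : Matrix (Finset (Orb (FermionTorus 2 L))) (Finset (Orb (FermionTorus 2 L))) ℂ :=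
    ∑ x : FermionTorus 2 L, numberOp x 0 * numberOp x 1 with hD
  set Q : Matrix (Finset (Orb (FermionTorus 2 L))) (Finset (Orb (FermionTorus 2 L))) ℂ :=
    (pairField dWaveFormFactor L)ᴴ * pairField dWaveFormFactor L with hQ
  set K : Submodule ℂ (Fock (Orb (FermionTorus 2 L))) := szSector (2 * n) 0 with hK
  have hHU : ∀ V : ℝ, H V = H 0 + (V : ℂ) • D := fun V => hubbardTorus_eq_add_smul L V
  have hHerm : ∀ V : ℝ, (H V).IsHermitian := fun V =>
    (hamiltonian_isHermitian_and_commute_holds (fermionTorusGraph 2 L) 1 V).1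
  -- a normalised ground state at each coupling
  have hex : ∀ j : ℕ, ∃ ψ : Fock (Orb (FermionTorus 2 L)), star ψ ⬝ᵥ ψ = 1 ∧
      IsGroundStateInSector (H (U j)) (2 * n) 0 ψ := fun j => exists_unit_groundStateInSector L (U j) hn
  choose ψ hψ1 hψGS using hex
  -- compactness: a convergent subsequence
  obtain ⟨ψinf, hψinf1, g, hg, hlim⟩ :=
    (isCompact_unitSphere_fock L).tendsto_subseq (x := ψ) (fun j => hψ1 j)
  rw [Set.mem_setOf_eq] at hψinf1
  -- continuity tools
  have hcmul : ∀ A : Matrix (Finset (Orb (FermionTorus 2 L))) (Finset (Orb (FermionTorus 2 L))) ℂ,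
      Continuous fun v : Fock (Orb (FermionTorus 2 L)) => A *ᵥ v :=
    fun A => continuous_const.matrix_mulVec continuous_id
  have hcdot : Continuous fun p : Fock (Orb (FermionTorus 2 L)) × Fock (Orb (FermionTorus 2 L)) =>
      star p.1 ⬝ᵥ p.2 := (continuous_fst.star).dotProduct continuous_snd
  have hUg : Tendsto (fun i => ((U (g i) : ℝ) : ℂ)) atTop (𝓝 0) := by
    have h := (Complex.continuous_ofReal.tendsto 0).comp (hU0.comp hg.tendsto_atTop)
    rwa [Complex.ofReal_zero] at h
  -- `H(U_{g i}) ψ_{g i} → H(0) ψ∞`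
  have hHlim : Tendsto (fun i => H (U (g i)) *ᵥ ψ (g i)) atTop (𝓝 (H 0 *ᵥ ψinf)) := by
    have h1 : Tendsto (fun i => H 0 *ᵥ ψ (g i)) atTop (𝓝 (H 0 *ᵥ ψinf)) := ((hcmul (H 0)).tendsto _).comp hlim
    have h2 : Tendsto (fun i => D *ᵥ ψ (g i)) atTop (𝓝 (D *ᵥ ψinf)) := ((hcmul D).tendsto _).comp hlim
    have h3 := h1.add (hUg.smul h2)
    rw [zero_smul, add_zero] at h3
    refine h3.congr' (Eventually.of_forall fun i => ?_)
    show _ = H (U (g i)) *ᵥ ψ (g i)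
    rw [hHU (U (g i)), add_mulVec, smul_mulVec]
  -- the sector energies along the subsequence converge to `re⟨ψ∞, H(0) ψ∞⟩`
  set r : ℕ → ℝ := fun j => (H (U j)).minEnergyOn K with hr
  have hreig : ∀ j, star (ψ j) ⬝ᵥ (H (U j) *ᵥ ψ j) = ((r j : ℝ) : ℂ) := fun j => by
    rw [(hψGS j).2.2, dotProduct_smul, hψ1 j, smul_eq_mul, mul_one]
  set cinf : ℂ := star ψinf ⬝ᵥ (H 0 *ᵥ ψinf) with hcinf
  have hclim : Tendsto (fun i => ((r (g i) : ℝ) : ℂ)) atTop (𝓝 cinf) := by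
    have h := (hcdot.tendsto (ψinf, H 0 *ᵥ ψinf)).comp (hlim.prodMk_nhds hHlim)
    refine h.congr' (Eventually.of_forall fun i => ?_)
    simp only [Function.comp_apply]
    exact hreig (g i)
  have hrlim : Tendsto (fun i => r (g i)) atTop (𝓝 cinf.re) := by
    have h := (Complex.continuous_re.tendsto cinf).comp hclim
    refine h.congr' (Eventually.of_forall fun i => ?_)
    simp only [Function.comp_apply, Complex.ofReal_re]
  have hcim : cinf.im = 0 := by
    have h := (Complex.continuous_im.tendsto cinf).comp hclim
    have h0 : Tendsto (fun i : ℕ => ((r (g i) : ℝ) : ℂ).im) atTop (𝓝 0) := by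
      simp only [Complex.ofReal_im]; exact tendsto_const_nhds
    exact tendsto_nhds_unique h h0
  have hcre : cinf = ((cinf.re : ℝ) : ℂ) := Complex.ext (by simp) (by simp [hcim])
  -- the eigen-equation passes to the limit
  have heig : H 0 *ᵥ ψinf = cinf • ψinf := by
    have h1 : Tendsto (fun i => H (U (g i)) *ᵥ ψ (g i)) atTop (𝓝 (cinf • ψinf)) := by
      have h := hclim.smul hlim
      refine h.congr' (Eventually.of_forall fun i => ?_)
      simp only [Function.comp_apply]
      rw [(hψGS (g i)).2.2]
    exact tendsto_nhds_unique hHlim h1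
  -- `ψ∞` lies in the sector and is normalised
  have hKclosed : IsClosed (K : Set (Fock (Orb (FermionTorus 2 L)))) := K.closed_of_finiteDimensional
  have hψinfK : ψinf ∈ K :=
    hKclosed.mem_of_tendsto hlim (Eventually.of_forall fun i => (hψGS (g i)).1)
  have hψinf0 : ψinf ≠ 0 := by
    intro h
    rw [h, star_zero, zero_dotProduct] at hψinf1
    exact zero_ne_one hψinf1
  -- `re cinf` is the free sector energy
  have hge : (H 0).minEnergyOn K ≤ cinf.re := minEnergyOn_le_rayleigh_of_mem (hHerm 0) K hψinfK hψinf1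
  have hle : cinf.re ≤ (H 0).minEnergyOn K := by
    refine le_csInf ⟨_, ψinf, hψinfK, hψinf1, rfl⟩ ?_
    rintro E ⟨φ, hφK, hφ1, rfl⟩
    -- `r_{g i} ≤ re⟨φ, H(U_{g i}) φ⟩ → re⟨φ, H(0) φ⟩`
    have hφlim : Tendsto (fun i => (star φ ⬝ᵥ (H (U (g i)) *ᵥ φ)).re) atTop
        (𝓝 ((star φ ⬝ᵥ (H 0 *ᵥ φ)).re)) := by
      have h1 : Tendsto (fun i => (star φ ⬝ᵥ (H 0 *ᵥ φ)).re + U (g i) * (star φ ⬝ᵥ (D *ᵥ φ)).re) atTop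
          (𝓝 ((star φ ⬝ᵥ (H 0 *ᵥ φ)).re + 0 * (star φ ⬝ᵥ (D *ᵥ φ)).re)) :=
        tendsto_const_nhds.add ((hU0.comp hg.tendsto_atTop).mul tendsto_const_nhds)
      rw [zero_mul, add_zero] at h1
      refine h1.congr' (Eventually.of_forall fun i => ?_)
      show _ = (star φ ⬝ᵥ (H (U (g i)) *ᵥ φ)).re
      rw [hHU (U (g i)), add_mulVec, smul_mulVec, dotProduct_add, dotProduct_smul, Complex.add_re,
        smul_eq_mul, Complex.re_ofReal_mul]
    exact le_of_tendsto_of_tendsto' hrlim hφlim fun i =>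
      minEnergyOn_le_rayleigh_of_mem (hHerm (U (g i))) K hφK hφ1
  have hc_eq : cinf.re = (H 0).minEnergyOn K := le_antisymm hle hge
  -- so `ψ∞` is a free ground state in the sector
  have hGSinf : IsGroundStateInSector (H 0) (2 * n) 0 ψinf := by
    refine ⟨hψinfK, hψinf0, ?_⟩
    rw [heig, hcre, hc_eq]
  -- the floor passes to the limit and contradicts the free bound
  have hIcont : Continuous fun v : Fock (Orb (FermionTorus 2 L)) => (star v ⬝ᵥ (Q *ᵥ v)).re :=
    Complex.continuous_re.comp ((continuous_id.star).dotProduct (hcmul Q))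
  have hIlim : Tendsto (fun i => (star (ψ (g i)) ⬝ᵥ (Q *ᵥ ψ (g i))).re) atTop
      (𝓝 ((star ψinf ⬝ᵥ (Q *ᵥ ψinf)).re)) := (hIcont.tendsto ψinf).comp hlim
  have hfloor_inf : a ≤ (star ψinf ⬝ᵥ (Q *ᵥ ψinf)).re :=
    ge_of_tendsto hIlim (Eventually.of_forall fun i => hfloor (g i) (ψ (g i)) (hψGS (g i)) (hψ1 (g i)))
  have hfree_inf := hfree ψinf hGSinf hψinf1
  change (star ψinf ⬝ᵥ (Q *ᵥ ψinf)).re ≤ C at hfree_inf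
  linarith

/-- **The doubly-uniform strengthening of `CwThesis` is false, modulo the free bound.** If every normalised
sector ground state of the free torus (`L ≥ 3`) has pair intensity `≤ C L²`, then there are NO `U₀, a, k₀` such
that for every `U ∈ (0, U₀)` some doping `δ_U` of the window carries the floor `a L⁴` for ALL ground states at ALL
even sides `L = 2k+2 ≥ 2k₀+2`: along `U_j = U₀/(j+2) → 0` the prescribed particle numbers at a fixed large side
repeat infinitely often (pigeonhole), and `no_floor_along_vanishing_couplings` applies in that sector. (Compare
`cwThesis_iff_floor`: `X` itself lets both `a` and the threshold depend on `U`.) [folklore] -/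
theorem cwThesis_false_uniformFloor_of_freeBound {C : ℝ}
    (hfree : ∀ (L : ℕ) [NeZero L], 3 ≤ L → ∀ (n : ℕ) (ψ : Fock (Orb (FermionTorus 2 L))),
      IsGroundStateInSector (hubbardTorus 2 L 1 0) (2 * n) 0 ψ → star ψ ⬝ᵥ ψ = 1 →
        (expect ((pairField dWaveFormFactor L)ᴴ * pairField dWaveFormFactor L) ψ).re ≤ C * (L : ℝ) ^ 2) :
    ¬ ∃ U₀ a : ℝ, ∃ k₀ : ℕ, 0 < U₀ ∧ 0 < a ∧ ∀ U ∈ Ioo (0:ℝ) U₀, ∃ δ ∈ Icc (3/10 : ℝ) (12/25),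
        ∀ k : ℕ, k₀ ≤ k → ∀ ψ : Fock (Orb (FermionTorus 2 (2 * k + 1 + 1))),
          IsGroundStateInSector (hubbardTorus 2 (2 * k + 1 + 1) 1 U)
              (2 * ⌊(1 - δ) * (((2 * k + 1 + 1 : ℕ) : ℝ)) ^ 2 / 2⌋₊) 0 ψ →
            star ψ ⬝ᵥ ψ = 1 →
              a * ((2 * k + 1 + 1 : ℕ) : ℝ) ^ 4 ≤
                (expect ((pairField dWaveFormFactor (2 * k + 1 + 1))ᴴ *
                  pairField dWaveFormFactor (2 * k + 1 + 1)) ψ).re := by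
  classical
  rintro ⟨U₀, a, k₀, hU₀, ha, h⟩
  -- a large even side `2k+2`, `k ≥ k₀`, with `C (2k+2)² < a (2k+2)⁴`
  obtain ⟨m, hm⟩ := exists_nat_gt (C / a)
  obtain ⟨k, hk₀, hkm⟩ : ∃ k : ℕ, k₀ ≤ k ∧ m + 1 ≤ k := ⟨max k₀ (m + 1), le_max_left _ _, le_max_right _ _⟩
  haveI : NeZero (2 * k + 1 + 1) := ⟨by omega⟩
  have hL3 : 3 ≤ 2 * k + 1 + 1 := by omega
  have hLm : (m : ℝ) + 1 ≤ ((2 * k + 1 + 1 : ℕ) : ℝ) := by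
    have : m + 1 ≤ 2 * k + 1 + 1 := by omega
    exact_mod_cast this
  have hLpos : (0 : ℝ) < ((2 * k + 1 + 1 : ℕ) : ℝ) ^ 2 := by positivity
  have hCa : C * ((2 * k + 1 + 1 : ℕ) : ℝ) ^ 2 < a * ((2 * k + 1 + 1 : ℕ) : ℝ) ^ 4 := by
    have h1 : C < a * ((2 * k + 1 + 1 : ℕ) : ℝ) ^ 2 := by
      have hCa' : C / a < ((2 * k + 1 + 1 : ℕ) : ℝ) ^ 2 := by
        calc C / a < m := hm
          _ ≤ (m : ℝ) + 1 := by linarith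
          _ ≤ ((2 * k + 1 + 1 : ℕ) : ℝ) := hLm
          _ ≤ ((2 * k + 1 + 1 : ℕ) : ℝ) ^ 2 := by
              have h1 : (1:ℝ) ≤ ((2 * k + 1 + 1 : ℕ) : ℝ) := by
                have : 1 ≤ 2 * k + 1 + 1 := by omega
                exact_mod_cast this
              nlinarith
      rw [div_lt_iff₀ ha] at hCa'
      linarith [mul_comm a (((2 * k + 1 + 1 : ℕ) : ℝ) ^ 2)]
    have h4 : ((2 * k + 1 + 1 : ℕ) : ℝ) ^ 4 = ((2 * k + 1 + 1 : ℕ) : ℝ) ^ 2 * ((2 * k + 1 + 1 : ℕ) : ℝ) ^ 2 := by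
      ring
    rw [h4, ← mul_assoc]
    exact mul_lt_mul_of_pos_right h1 hLpos
  -- couplings `V_j = U₀/(j+2) → 0` inside `(0, U₀)`
  obtain ⟨V, hV⟩ : ∃ V : ℕ → ℝ, ∀ j, V j = U₀ / ((j : ℝ) + 2) := ⟨_, fun j => rfl⟩
  have hVmem : ∀ j, V j ∈ Ioo (0:ℝ) U₀ := fun j => by
    rw [hV]
    refine ⟨div_pos hU₀ (by positivity), ?_⟩
    rw [div_lt_iff₀ (by positivity)]
    nlinarith
  have hV0 : Tendsto V atTop (𝓝 0) := by
    have h1 : Tendsto (fun j : ℕ => (j : ℝ) + 2) atTop atTop :=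
      tendsto_natCast_atTop_atTop.atTop_add tendsto_const_nhds
    have h3 := h1.inv_tendsto_atTop.const_mul U₀
    rw [mul_zero] at h3
    refine h3.congr' (Eventually.of_forall fun j => ?_)
    rw [hV j, div_eq_mul_inv]
    rfl
  -- dopings and particle numbers at the chosen side
  choose δ hδ hfl using fun j => h (V j) (hVmem j)
  obtain ⟨nL, hnL⟩ : ∃ nL : ℕ → ℕ, ∀ j, nL j = ⌊(1 - δ j) * (((2 * k + 1 + 1 : ℕ) : ℝ)) ^ 2 / 2⌋₊ :=
    ⟨_, fun j => rfl⟩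
  have hnL_le : ∀ j, nL j ≤ (2 * k + 1 + 1) ^ 2 := fun j => by
    rw [hnL]
    exact halfFilling_floor_le_sq (2 * k + 1 + 1) (by linarith [(hδ j).1])
  -- pigeonhole: some particle number repeats infinitely often
  obtain ⟨y, hy⟩ := Finite.exists_infinite_fiber
    (fun j : ℕ => (⟨nL j, Nat.lt_succ_of_le (hnL_le j)⟩ : Fin ((2 * k + 1 + 1) ^ 2 + 1)))
  have hfreq : ∃ᶠ j in atTop, nL j = y.val := by
    rw [Nat.frequently_atTop_iff_infinite]
    have hinf := Set.infinite_coe_iff.1 hy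
    refine hinf.mono fun j hj => ?_
    simp only [Set.mem_preimage, Set.mem_singleton_iff] at hj
    simp only [Set.mem_setOf_eq, ← hj]
  obtain ⟨φ, hφ, hφP⟩ := Filter.extraction_of_frequently_atTop hfreq
  -- apply the fixed-sector lemma along `V ∘ φ` in the sector `(2 y, 0)`
  have hy_le : y.val ≤ (2 * k + 1 + 1) ^ 2 := Nat.le_of_lt_succ y.isLt
  refine no_floor_along_vanishing_couplings (L := 2 * k + 1 + 1) hy_le hCa
    (fun ψ hψ hψ1 => hfree (2 * k + 1 + 1) hL3 y.val ψ hψ hψ1) (V ∘ φ) (hV0.comp hφ.tendsto_atTop)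
    fun i ψ hψ hψ1 => ?_
  have hfl' := hfl (φ i) k hk₀ ψ
  have e : ⌊(1 - δ (φ i)) * (((2 * k + 1 + 1 : ℕ) : ℝ)) ^ 2 / 2⌋₊ = y.val := by
    rw [← hnL]
    exact hφP i
  rw [e] at hfl'
  exact hfl' hψ hψ1

end Summit.HubbardSuperconductivity.CwThesis.Negative

end
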